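import Mathlib
import Summits.MatrixMultiplication.MatrixMultiplication.Theorems.GradedDesignFamily.Negative.CuspFormWall

/-!
# Trace forms: a cuspidality criterion, and the wall they give
# (crux `LevelGradedCohnUmans.GradedDesignFamily`, stmt-MatrixMultiplication-7610; negative side,
# line `quadratic-extension-level-one-cell`, stub S3 `stub_subfieldCell`)

HONEST FRAMING.  Engine for DECIDING the finite cells `q = 4, 5` of S3 by theorem; a verdict /
certificate, not summit progress.

* `traceForm_cusp` — the TRACE SWEEP: a class function `e(M) = τ(tr M)` on `SL₂(k)` is cuspidal
  for every conjugate root group as soon as `Σ_t τ(t) = 0` and `τ(a + a⁻¹) = 0` for all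
  `a ≠ 0`.  (For `g = [[a, b], [c, d]]`, `tr(g u_x) = a + d + c x` sweeps `k` when `c ≠ 0`,
  and is the constant `a + a⁻¹` when `c = 0`.)
* `subfieldCell_wall_of_traceForm` — hence, by `cuspFormWall`, such a `τ` not vanishing on some
  trace bounds S3's configuration: `|Y| + |Z| ≤ (|K| + 1)(|k| − 1) + 1`.

Sorry-free; axioms `propext`, `Classical.choice`, `Quot.sound`.
-/

set_option linter.dupNamespace false

open scoped BigOperators
open Matrix

namespace Summit.MatrixMultiplication.MatrixMultiplication.Theorems.GradedDesignFamily.Negative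

/-- **Trace sweep.**  If `Σ_t τ(t) = 0` and `τ(a + a⁻¹) = 0` for every `a ≠ 0`, then
`M ↦ τ(tr M)` is cuspidal on `SL₂(k)` for every conjugate of the root group. [folklore] -/
theorem traceForm_cusp {k : Type} [Field k] [Fintype k] [DecidableEq k] (τ : k → ℂ)
    (h1 : ∑ t : k, τ t = 0) (h2 : ∀ a : k, a ≠ 0 → τ (a + a⁻¹) = 0) :
    ∀ g b : Matrix.SpecialLinearGroup (Fin 2) k,
      ∑ x : k, τ (Matrix.trace (((g * b * ⟨!![(1 : k), x; 0, 1], sl2md_det_upper x⟩ * b⁻¹ :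
        Matrix.SpecialLinearGroup (Fin 2) k) : Matrix (Fin 2) (Fin 2) k))) = 0 := by
  intro g b
  set g' : Matrix.SpecialLinearGroup (Fin 2) k := b⁻¹ * g * b with hg'
  -- conjugation invariance of the trace
  have htr : ∀ x : k, Matrix.trace (((g * b * ⟨!![(1 : k), x; 0, 1], sl2md_det_upper x⟩ * b⁻¹ :
      Matrix.SpecialLinearGroup (Fin 2) k) : Matrix (Fin 2) (Fin 2) k)) =
      Matrix.trace (((g' * ⟨!![(1 : k), x; 0, 1], sl2md_det_upper x⟩ :
        Matrix.SpecialLinearGroup (Fin 2) k) : Matrix (Fin 2) (Fin 2) k)) := by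
    intro x
    have hx : g * b * ⟨!![(1 : k), x; 0, 1], sl2md_det_upper x⟩ * b⁻¹ =
        b * (g' * ⟨!![(1 : k), x; 0, 1], sl2md_det_upper x⟩) * b⁻¹ := by
      rw [hg']; group
    rw [hx, Matrix.SpecialLinearGroup.coe_mul, Matrix.SpecialLinearGroup.coe_mul,
      Matrix.trace_mul_cycle, ← Matrix.SpecialLinearGroup.coe_mul, inv_mul_cancel,
      Matrix.SpecialLinearGroup.coe_one, Matrix.one_mul]
  simp_rw [htr]
  -- entries of `g'`
  set a : k := (g' : Matrix (Fin 2) (Fin 2) k) 0 0 with ha_def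
  set β : k := (g' : Matrix (Fin 2) (Fin 2) k) 0 1 with hβ_def
  set c : k := (g' : Matrix (Fin 2) (Fin 2) k) 1 0 with hc_def
  set d : k := (g' : Matrix (Fin 2) (Fin 2) k) 1 1 with hd_def
  have hdet : a * d - β * c = 1 := by
    have h := g'.2
    rw [Matrix.det_fin_two] at h
    exact h
  have htr' : ∀ x : k, Matrix.trace (((g' * ⟨!![(1 : k), x; 0, 1], sl2md_det_upper x⟩ :
      Matrix.SpecialLinearGroup (Fin 2) k) : Matrix (Fin 2) (Fin 2) k)) = a + d + c * x := by
    intro x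
    rw [Matrix.SpecialLinearGroup.coe_mul, Matrix.trace_fin_two]
    simp [Matrix.mul_apply, Fin.sum_univ_two, ha_def, hc_def, hd_def]
    ring
  simp_rw [htr']
  by_cases hc : c = 0
  · -- constant trace `a + a⁻¹`
    have had : a * d = 1 := by rw [hc, mul_zero, sub_zero] at hdet; exact hdet
    have ha : a ≠ 0 := left_ne_zero_of_mul_eq_one had
    have hd : d = a⁻¹ := (inv_eq_of_mul_eq_one_right had).symm
    simp only [hc, zero_mul, add_zero]
    rw [Finset.sum_const, hd, h2 a ha, smul_zero]
  · -- the traces sweep `k`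
    rw [Fintype.sum_bijective (fun x : k => a + d + c * x)
      ((Finite.injective_iff_bijective).1 fun x y hxy =>
        mul_left_cancel₀ hc (add_left_cancel hxy)) _ τ fun x => rfl]
    exact h1

/-- **The trace-form wall.**  In S3's subfield-cell configuration, any `τ : k → ℂ` with
`Σ τ = 0`, `τ(a + a⁻¹) = 0` for `a ≠ 0`, and `τ(tr M₀) ≠ 0` for some `M₀ ∈ SL₂(k)` gives
`|Y| + |Z| ≤ (|K| + 1)(|k| − 1) + 1` (`cuspFormWall` with `e = τ ∘ tr`). [folklore] -/
theorem subfieldCell_wall_of_traceForm {k K : Type} [Field k] [Fintype k] [DecidableEq k]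
    [Field K] [Fintype K] [DecidableEq K]
    (φ : Matrix.SpecialLinearGroup (Fin 2) k →* Matrix.GeneralLinearGroup (Fin 2) K)
    (hφ : Function.Injective φ) (hK : Fintype.card K = Fintype.card k ^ 2)
    (Y Z : Finset (Matrix.GeneralLinearGroup (Fin 2) K)) (hY : Y.Nonempty) (hZ : Z.Nonempty)
    (hsep : ∀ z₀ ∈ Z, ∃ cf : (Fin 2 → K) → (Fin 2 → K) → ℂ,
      ∀ a : Matrix.SpecialLinearGroup (Fin 2) k, ∀ y ∈ Y, ∀ y' ∈ Y, ∀ z ∈ Z,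
        (∑ u : Fin 2 → K, cf u (((φ a * y * y'⁻¹ * z : Matrix.GeneralLinearGroup (Fin 2) K) :
            Matrix (Fin 2) (Fin 2) K).mulVec u)) =
          if a = 1 ∧ y = y' ∧ z = z₀ then 1 else 0)
    (τ : k → ℂ) (h1 : ∑ t : k, τ t = 0) (h2 : ∀ a : k, a ≠ 0 → τ (a + a⁻¹) = 0)
    (M₀ : Matrix.SpecialLinearGroup (Fin 2) k)
    (h0 : τ (Matrix.trace (M₀ : Matrix (Fin 2) (Fin 2) k)) ≠ 0) :
    Y.card + Z.card ≤ (Fintype.card K + 1) * (Fintype.card k - 1) + 1 :=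
  cuspFormWall φ hφ hK Y Z hY hZ hsep
    (fun M : Matrix.SpecialLinearGroup (Fin 2) k => τ (Matrix.trace (M : Matrix (Fin 2) (Fin 2) k)))
    ⟨M₀, h0⟩ (traceForm_cusp τ h1 h2)

end Summit.MatrixMultiplication.MatrixMultiplication.Theorems.GradedDesignFamily.Negative
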